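import Literature.Barriers.RiemannHypothesis.DavenportHeilbronnHamburgerTools
import Literature.Analysis.Complex.HolomorphicParametricIntegral
import Literature.Analysis.SpecialFunctions.GammaProductBounds
import Mathlib.Analysis.SpecialFunctions.Complex.Arg
import Mathlib.Analysis.Complex.Convex
import HarnessLib

/-!
# The Cahen–Mellin integral in the open right half-plane

Topic `Literature/Analysis/Complex` (vertical-line contour integration; continues
`CahenMellinDirichlet.lean`). Everything here is PROVED; there are no named facts and no
definitions.

The tree has the Cahen–Mellin integral `e^{-x} = (1/2πi) ∫_{(c)} Γ(s) x^{-s} ds` for REAL `x > 0`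
(`Literature.Analysis.Complex.exp_neg_eq_mellinInv_Gamma`, `0 < c ≤ 2`;
`Literature.Barriers.RiemannHypothesis.Hamburger1921.exp_neg_eq_mellinInv_Gamma_of_pos`, every
`c > 0`). This file extends it to COMPLEX arguments in the open right half-plane:

* `exists_norm_Gamma_vertical_le` — on every vertical line `re s = c > 0`,
  `‖Γ(c + iu)‖ ≤ K (1 + |u|)^N e^{-π|u|/2}` for some `K, N ≥ 0` (from the tree's
  `norm_Gamma_add_nat_le` and `Γ(s) = Γ(s+1)/s`);
* `integral_Gamma_mul_cpow_neg_eq` — **Cahen–Mellin in a sector**: for `c > 0` and `re z > 0`,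
  `∫ Γ(c + iy) z^{-(c+iy)} dy = 2π e^{-z}`, i.e. `e^{-z} = (1/2πi) ∫_{(c)} Γ(s) z^{-s} ds`
  (principal branch of `z^{-s}`). Proof: both sides are holomorphic in `z` on the half-plane — the
  left by holomorphy of dominated parameter integrals
  (`differentiableOn_integral_of_dominated`), the majorant on a ball around `z₀` being
  `K r^{-c} (1+|y|)^N e^{-(π/2 - θ₀)|y|}` with `θ₀ < π/2` the maximum of `|arg|` on the closed ball
  (`‖z^{-(c+iy)}‖ = ‖z‖^{-c} e^{y arg z}`) — and they agree for real `z > 0`, hence everywhere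
  (identity theorem on the convex half-plane);
* `cpow_mul_exp_neg_eq_integral` — the same for `F(z) = z^a e^{-z}`:
  `z^a e^{-z} = (1/2πi) ∫_{(c)} Γ(s + a) z^{-s} ds` for `re z > 0`, `c + re a > 0` — Booker's (10)
  (A. R. Booker, Ann. of Math. 158 (2003), p. 1093: "Let `F(z) = z^c e^{-z}` for `re z > 0`.
  Recall the Mellin transform identity (10) `F(z) = (1/2πi) ∫ Γ(s + c) z^{-s} ds`"), the kernel of
  the Conrey–Ghosh transform (Booker's Lemma 2).

## References

* A. R. Booker, *Poles of Artin L-functions and the strong Artin conjecture*, Ann. of Math. (2)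
  158 (2003), 1089–1098: (10), p. 1093. [Booker2003]
* E. C. Titchmarsh, *The Theory of the Riemann Zeta-Function*, §2.15 (Cahen–Mellin). [folklore]
-/

noncomputable section

open _root_.Complex Set MeasureTheory Filter Real Metric
open scoped _root_.Topology

namespace Literature.Analysis.Complex

open Literature.Analysis.SpecialFunctions Literature.Barriers.RiemannHypothesis.Hamburger1921

/-! ### A polynomial-times-`e^{-π|u|/2}` bound for `Γ` on every vertical line `re s > 0` -/

/-- For `1 ≤ c`: `‖Γ(c + iu)‖ ≤ K (1+|u|)^N e^{-π|u|/2}` with `K, N ≥ 0` depending on `c`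
(write `c = x + n`, `x ∈ [1, 2]`, and use the tree's `norm_Gamma_add_nat_le`). [folklore] -/
theorem exists_norm_Gamma_vertical_le_of_one_le {c : ℝ} (hc1 : 1 ≤ c) :
    ∃ K N : ℝ, 0 ≤ K ∧ 0 ≤ N ∧ ∀ u : ℝ,
      ‖Complex.Gamma (c + u * I)‖ ≤ K * (1 + |u|) ^ N * Real.exp (-(π / 2 * |u|)) := by
  set n : ℕ := ⌊c⌋₊ - 1 with hn
  have hfl : 1 ≤ ⌊c⌋₊ := Nat.le_floor (by exact_mod_cast hc1)
  have hnR : (n : ℝ) = ⌊c⌋₊ - 1 := by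
    rw [hn, Nat.cast_sub hfl]; norm_num
  set x : ℝ := c - n with hx
  have hx1 : 1 ≤ x := by
    have := Nat.floor_le (by linarith : (0 : ℝ) ≤ c); rw [hx, hnR]; linarith
  have hx2 : x ≤ 2 := by
    have := Nat.lt_floor_add_one c; rw [hx, hnR]; linarith
  have hcx : x + n = c := by rw [hx]; ring
  refine ⟨16 * π ^ 2 * (x + n) ^ n, (n : ℝ) + 3 / 2, by positivity, by positivity, fun u ↦ ?_⟩
  have h := norm_Gamma_add_nat_le hx1 hx2 n u
  rw [hcx] at h
  have hu : 0 ≤ |u| := abs_nonneg u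
  have hprod : ∏ k ∈ Finset.range n, (x + k + |u|) ≤ ((x + n) * (1 + |u|)) ^ n := by
    rw [← Finset.card_range n, ← Finset.prod_const, Finset.card_range]
    refine Finset.prod_le_prod (fun k _ ↦ by positivity) fun k hk ↦ ?_
    have hk' : (k : ℝ) ≤ n := by exact_mod_cast (Finset.mem_range.1 hk).le
    nlinarith
  have he : Real.exp (-(π * |u|) / 2) = Real.exp (-(π / 2 * |u|)) := by congr 1; ring
  have hsplit : (1 + |u|) ^ ((n : ℝ) + 3 / 2) = (1 + |u|) ^ n * (1 + |u|) ^ (3 / 2 : ℝ) := by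
    rw [Real.rpow_add (by positivity), Real.rpow_natCast]
  calc ‖Complex.Gamma (c + u * I)‖
      ≤ 16 * π ^ 2 * (1 + |u|) ^ (3 / 2 : ℝ) * Real.exp (-(π * |u|) / 2) *
          ∏ k ∈ Finset.range n, (x + k + |u|) := h
    _ ≤ 16 * π ^ 2 * (1 + |u|) ^ (3 / 2 : ℝ) * Real.exp (-(π * |u|) / 2) *
          ((x + n) * (1 + |u|)) ^ n := by gcongr
    _ = 16 * π ^ 2 * (x + n) ^ n * (1 + |u|) ^ ((n : ℝ) + 3 / 2) * Real.exp (-(π / 2 * |u|)) := by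
        rw [he, hsplit, mul_pow]; ring

/-- **`Γ` on vertical lines**: for every `c > 0` there are `K, N ≥ 0` with
`‖Γ(c + iu)‖ ≤ K (1+|u|)^N e^{-π|u|/2}` for all real `u` (the case `c ≥ 1` and
`Γ(s) = Γ(s + 1)/s`, `‖c + iu‖ ≥ c`). [folklore] -/
theorem exists_norm_Gamma_vertical_le {c : ℝ} (hc : 0 < c) :
    ∃ K N : ℝ, 0 ≤ K ∧ 0 ≤ N ∧ ∀ u : ℝ,
      ‖Complex.Gamma (c + u * I)‖ ≤ K * (1 + |u|) ^ N * Real.exp (-(π / 2 * |u|)) := by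
  obtain ⟨K, N, hK, hN, hb⟩ := exists_norm_Gamma_vertical_le_of_one_le (c := c + 1) (by linarith)
  refine ⟨K / c, N, by positivity, hN, fun u ↦ ?_⟩
  have hs0 : (c : ℂ) + u * I ≠ 0 := fun h ↦ by
    have := congrArg Complex.re h; simp at this; linarith
  have hnorm : c ≤ ‖(c : ℂ) + u * I‖ := by
    have h := abs_re_le_norm ((c : ℂ) + u * I)
    simp only [add_re, ofReal_re, mul_re, I_re, mul_zero, ofReal_im, I_im, mul_one, sub_self,
      add_zero, abs_of_pos hc] at h
    exact h
  have hfe : Complex.Gamma (c + u * I) = Complex.Gamma (c + u * I + 1) / (c + u * I) := by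
    rw [Complex.Gamma_add_one _ hs0, mul_div_cancel_left₀ _ hs0]
  have hb' := hb u
  rw [show ((c + 1 : ℝ) : ℂ) + u * I = c + u * I + 1 by push_cast; ring] at hb'
  rw [hfe, norm_div]
  calc ‖Complex.Gamma (c + u * I + 1)‖ / ‖(c : ℂ) + u * I‖
      ≤ (K * (1 + |u|) ^ N * Real.exp (-(π / 2 * |u|))) / c :=
        div_le_div₀ (by positivity) hb' hc hnorm
    _ = K / c * (1 + |u|) ^ N * Real.exp (-(π / 2 * |u|)) := by ring

/-! ### The Cahen–Mellin integral for complex argument -/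

/-- `‖z^{-(c+iy)}‖ = ‖z‖^{-c} e^{y arg z}` for `z ≠ 0`. [folklore] -/
theorem norm_cpow_neg_add_mul_I_of_ne_zero {z : ℂ} (hz : z ≠ 0) (c y : ℝ) :
    ‖z ^ (-((c : ℂ) + y * I))‖ = ‖z‖ ^ (-c) * Real.exp (y * arg z) := by
  rw [Complex.norm_cpow_of_ne_zero hz, div_eq_mul_inv, ← Real.exp_neg]
  congr 2
  · simp
  · simp; ring

/-- The Cahen–Mellin integrand `y ↦ Γ(c + iy) z^{-(c+iy)}` is continuous for `c > 0`, `z ≠ 0`.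
[folklore] -/
theorem continuous_Gamma_mul_cpow_neg {c : ℝ} (hc : 0 < c) {z : ℂ} (hz : z ≠ 0) :
    Continuous fun y : ℝ ↦ Complex.Gamma (c + y * I) * z ^ (-((c : ℂ) + y * I)) := by
  refine continuous_iff_continuousAt.2 fun y ↦ ContinuousAt.mul ?_ ?_
  · have hΓ : DifferentiableAt ℂ Complex.Gamma ((c : ℂ) + y * I) := by
      refine Complex.differentiableAt_Gamma _ fun m h ↦ ?_
      have h1 := congrArg Complex.re h
      simp only [add_re, ofReal_re, mul_re, I_re, mul_zero, ofReal_im, I_im, mul_one, sub_self,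
        add_zero, neg_re, natCast_re] at h1
      have : (0 : ℝ) ≤ m := Nat.cast_nonneg m
      linarith
    exact ContinuousAt.comp (f := fun y : ℝ ↦ (c : ℂ) + y * I) hΓ.continuousAt (by fun_prop)
  · exact (continuousAt_const_cpow hz).comp (by fun_prop)

/-- **Local majorant.** For `c > 0` and `re z₀ > 0` there are `R > 0` with
`ball z₀ R ⊆ {re z > 0}` and an integrable `bound` with
`‖Γ(c + iy) z^{-(c+iy)}‖ ≤ bound(y)` for all `z ∈ ball z₀ R` and all `y`
(`bound(y) = K R^{-c} (1+|y|)^N e^{-(π/2 - θ₀)|y|}`, `θ₀ = max_{closedBall z₀ R} |arg| < π/2`).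
[folklore] -/
theorem exists_bound_Gamma_mul_cpow_neg {c : ℝ} (hc : 0 < c) {z₀ : ℂ} (hz₀ : 0 < z₀.re) :
    ∃ R : ℝ, 0 < R ∧ ball z₀ R ⊆ {z : ℂ | 0 < z.re} ∧ ∃ bound : ℝ → ℝ, Integrable bound ∧
      ∀ y : ℝ, ∀ z ∈ ball z₀ R,
        ‖Complex.Gamma (c + y * I) * z ^ (-((c : ℂ) + y * I))‖ ≤ bound y := by
  obtain ⟨K, N, hK, hN, hb⟩ := exists_norm_Gamma_vertical_le hc
  set R : ℝ := z₀.re / 2 with hR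
  have hR0 : 0 < R := by positivity
  -- real parts on the closed ball
  have hre : ∀ z ∈ closedBall z₀ R, R ≤ z.re := by
    intro z hz
    have h1 : |(z - z₀).re| ≤ ‖z - z₀‖ := abs_re_le_norm _
    have h2 : ‖z - z₀‖ ≤ R := by rwa [mem_closedBall, dist_eq_norm] at hz
    rw [sub_re] at h1
    have := (abs_le.1 (h1.trans h2)).1
    linarith
  have hball : ball z₀ R ⊆ {z : ℂ | 0 < z.re} := fun z hz ↦
    lt_of_lt_of_le hR0 (hre z (ball_subset_closedBall hz))
  -- `θ₀`: the maximum of `|arg|` on the closed ball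
  have hcont : ContinuousOn (fun z : ℂ ↦ |arg z|) (closedBall z₀ R) := by
    refine fun z hz ↦ (ContinuousAt.comp (g := fun t : ℝ ↦ |t|) (by fun_prop) ?_).continuousWithinAt
    exact Complex.continuousAt_arg (Complex.mem_slitPlane_iff.2 (Or.inl (hR0.trans_le (hre z hz))))
  obtain ⟨z₁, hz₁, hmax⟩ :=
    (isCompact_closedBall z₀ R).exists_isMaxOn (nonempty_closedBall.2 hR0.le) hcont
  set θ₀ : ℝ := |arg z₁| with hθ₀
  have hθ₀lt : θ₀ < π / 2 :=
    Complex.abs_arg_lt_pi_div_two_iff.2 (Or.inl (hR0.trans_le (hre z₁ hz₁)))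
  have hθ : ∀ z ∈ closedBall z₀ R, |arg z| ≤ θ₀ := fun z hz ↦ hmax hz
  have ha : 0 < π / 2 - θ₀ := by linarith
  refine ⟨R, hR0, hball, fun y ↦ K * R ^ (-c) * ((1 + |y|) ^ N * Real.exp (-((π / 2 - θ₀) * |y|))),
    (integrable_one_add_abs_rpow_mul_exp_neg ha hN).const_mul (K * R ^ (-c)), fun y z hz ↦ ?_⟩
  have hzc := ball_subset_closedBall hz
  have hzre := hre z hzc
  have hz0 : z ≠ 0 := fun h ↦ by rw [h] at hzre; simp at hzre; linarith
  have hnz : R ≤ ‖z‖ := hzre.trans (Complex.re_le_norm z)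
  rw [norm_mul, norm_cpow_neg_add_mul_I_of_ne_zero hz0]
  have h1 : ‖z‖ ^ (-c) ≤ R ^ (-c) := Real.rpow_le_rpow_of_nonpos hR0 hnz (by linarith)
  have h2 : Real.exp (y * arg z) ≤ Real.exp (θ₀ * |y|) := by
    refine Real.exp_le_exp.2 ?_
    calc y * arg z ≤ |y * arg z| := le_abs_self _
      _ = |y| * |arg z| := abs_mul _ _
      _ ≤ |y| * θ₀ := by gcongr; exact hθ z hzc
      _ = θ₀ * |y| := mul_comm _ _
  calc ‖Complex.Gamma (c + y * I)‖ * (‖z‖ ^ (-c) * Real.exp (y * arg z))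
      ≤ (K * (1 + |y|) ^ N * Real.exp (-(π / 2 * |y|))) * (R ^ (-c) * Real.exp (θ₀ * |y|)) := by
        refine mul_le_mul (hb y) (mul_le_mul h1 h2 (by positivity) (by positivity))
          (by positivity) (by positivity)
    _ = K * R ^ (-c) * ((1 + |y|) ^ N * Real.exp (-((π / 2 - θ₀) * |y|))) := by
        have : Real.exp (-(π / 2 * |y|)) * Real.exp (θ₀ * |y|) =
            Real.exp (-((π / 2 - θ₀) * |y|)) := by
          rw [← Real.exp_add]; congr 1; ring
        rw [← this]; ring

/-- **The Cahen–Mellin integral is holomorphic in `z` on the right half-plane**: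
`z ↦ ∫ Γ(c + iy) z^{-(c+iy)} dy` is complex differentiable on `{re z > 0}` for `c > 0`
(dominated parameter integral). [folklore] -/
theorem differentiableOn_integral_Gamma_mul_cpow_neg {c : ℝ} (hc : 0 < c) :
    DifferentiableOn ℂ
      (fun z : ℂ ↦ ∫ y : ℝ, Complex.Gamma (c + y * I) * z ^ (-((c : ℂ) + y * I)))
      {z : ℂ | 0 < z.re} := by
  refine differentiableOn_integral_of_dominated (μ := volume)
    (F := fun (z : ℂ) (y : ℝ) ↦ Complex.Gamma (c + y * I) * z ^ (-((c : ℂ) + y * I))) ?_ ?_ ?_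
  · intro z hz
    have hz0 : z ≠ 0 := fun h ↦ by simp [h] at hz
    exact (continuous_Gamma_mul_cpow_neg hc hz0).aestronglyMeasurable
  · refine Eventually.of_forall fun y z hz ↦ ?_
    have hzs : z ∈ slitPlane := Complex.mem_slitPlane_iff.2 (Or.inl hz)
    exact ((differentiableAt_id.cpow (differentiableAt_const _) hzs).const_mul
      _).differentiableWithinAt
  · intro z₀ hz₀
    obtain ⟨R, hR, hball, bound, hbi, hb⟩ := exists_bound_Gamma_mul_cpow_neg hc hz₀
    exact ⟨R, hR, hball, bound, hbi, Eventually.of_forall hb⟩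

/-- **Cahen–Mellin integral in the right half-plane.** For `c > 0` and `re z > 0`,
`∫ Γ(c + iy) z^{-(c+iy)} dy = 2π e^{-z}`, i.e. `e^{-z} = (1/2πi) ∫_{(c)} Γ(s) z^{-s} ds` with
the principal branch of `z^{-s}`. (Titchmarsh, *Zeta-function*, §2.15; Booker 2003, (10) with
`c = 0`.) Both sides are holomorphic on the half-plane and agree for real `z > 0` (the tree's
`exp_neg_eq_mellinInv_Gamma_of_pos`), hence agree (identity theorem). [folklore] -/
theorem integral_Gamma_mul_cpow_neg_eq {c : ℝ} (hc : 0 < c) {z : ℂ} (hz : 0 < z.re) :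
    ∫ y : ℝ, Complex.Gamma (c + y * I) * z ^ (-((c : ℂ) + y * I)) = 2 * π * cexp (-z) := by
  set G : ℂ → ℂ := fun z ↦ ∫ y : ℝ, Complex.Gamma (c + y * I) * z ^ (-((c : ℂ) + y * I)) with hG
  set g : ℂ → ℂ := fun z ↦ 2 * π * cexp (-z) with hg
  have hopen : IsOpen {z : ℂ | 0 < z.re} := isOpen_lt continuous_const Complex.continuous_re
  have hGa : AnalyticOnNhd ℂ G {z : ℂ | 0 < z.re} :=
    (Complex.analyticOnNhd_iff_differentiableOn hopen).2
      (differentiableOn_integral_Gamma_mul_cpow_neg hc)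
  have hga : AnalyticOnNhd ℂ g {z : ℂ | 0 < z.re} :=
    (Complex.analyticOnNhd_iff_differentiableOn hopen).2 (by
      refine Differentiable.differentiableOn ?_
      simp only [hg]
      fun_prop)
  -- agreement on the positive real axis
  have hreal : ∀ x : ℝ, 0 < x → G x = g x := by
    intro x hx
    have h := exp_neg_eq_mellinInv_Gamma_of_pos hc hx
    have h2π : (2 * π : ℂ) ≠ 0 := by exact_mod_cast (by positivity : (2 * π : ℝ) ≠ 0)
    have hswap : G x = ∫ y : ℝ, (x : ℂ) ^ (-((c : ℂ) + y * I)) * Complex.Gamma (c + y * I) :=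
      integral_congr_ae (Eventually.of_forall fun y ↦ mul_comm _ _)
    have h' : (∫ y : ℝ, (x : ℂ) ^ (-((c : ℂ) + y * I)) * Complex.Gamma (c + y * I)) =
        2 * π * cexp (-x) := by
      rw [Complex.ofReal_exp, Complex.ofReal_neg] at h
      rw [← h, ← mul_assoc, mul_one_div_cancel h2π, one_mul]
    show G x = 2 * π * cexp (-(x : ℂ))
    rw [hswap, h']
  -- identity theorem on the (convex, hence preconnected) half-plane, at the point `1`
  have h1 : (1 : ℂ) ∈ {z : ℂ | 0 < z.re} := by simp
  have hfreq : ∃ᶠ w in 𝓝[≠] (1 : ℂ), G w = g w := by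
    have ht : Tendsto (fun t : ℝ ↦ ((1 + t : ℝ) : ℂ)) (𝓝[>] 0) (𝓝[≠] 1) := by
      refine tendsto_nhdsWithin_of_tendsto_nhds_of_eventually_within _ ?_ ?_
      · have hcts : Continuous fun t : ℝ ↦ ((1 + t : ℝ) : ℂ) := by fun_prop
        simpa using (hcts.tendsto 0).mono_left nhdsWithin_le_nhds
      · refine eventually_mem_nhdsWithin.mono fun t ht ↦ ?_
        have ht' : (0 : ℝ) < t := ht
        simp only [mem_compl_iff, mem_singleton_iff]
        intro h
        have := congrArg Complex.re h
        simp at this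
        linarith
    have hev : ∀ᶠ t in 𝓝[>] (0 : ℝ), G ((1 + t : ℝ) : ℂ) = g ((1 + t : ℝ) : ℂ) :=
      eventually_mem_nhdsWithin.mono fun t ht ↦ hreal (1 + t) (by
        have ht' : (0 : ℝ) < t := ht
        linarith)
    exact ht.frequently hev.frequently
  have hEq := hGa.eqOn_of_preconnected_of_frequently_eq hga
    (convex_halfSpace_re_gt 0).isPreconnected h1 hfreq
  exact hEq hz

/-- **Booker's (10): `F(z) = z^a e^{-z} = (1/2πi) ∫_{(σ)} Γ(s + a) z^{-s} ds`** for
`re z > 0`, on any line `re s = σ` with `σ + a > 0` (Booker 2003, p. 1093, with his `c` for `a`: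
"Let `F(z) = z^c e^{-z}` for `re z > 0`. Recall the Mellin transform identity (10)"), in the
parametrised form `∫ Γ(σ + a + iy) z^{-(σ+iy)} dy = 2π z^a e^{-z}` (principal branches). From
`integral_Gamma_mul_cpow_neg_eq` on the line `σ + a` and `z^{-(σ+iy)} = z^a · z^{-(σ+a+iy)}`.
[cite: Booker2003, (10) (p. 1093)] -/
theorem integral_Gamma_add_mul_cpow_neg_eq {σ a : ℝ} (hσa : 0 < σ + a) {z : ℂ} (hz : 0 < z.re) :
    ∫ y : ℝ, Complex.Gamma (σ + a + y * I) * z ^ (-((σ : ℂ) + y * I)) =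
      2 * π * (z ^ (a : ℂ) * cexp (-z)) := by
  have hz0 : z ≠ 0 := fun h ↦ by simp [h] at hz
  have key := integral_Gamma_mul_cpow_neg_eq (c := σ + a) hσa hz
  have hpt : ∀ y : ℝ, Complex.Gamma (σ + a + y * I) * z ^ (-((σ : ℂ) + y * I)) =
      z ^ (a : ℂ) * (Complex.Gamma (((σ + a : ℝ) : ℂ) + y * I) *
        z ^ (-(((σ + a : ℝ) : ℂ) + y * I))) := by
    intro y
    have h1 : -((σ : ℂ) + y * I) = (a : ℂ) + -(((σ + a : ℝ) : ℂ) + y * I) := by push_cast; ring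
    rw [h1, Complex.cpow_add _ _ hz0]
    push_cast
    ring
  simp_rw [hpt]
  rw [integral_const_mul, key]
  ring

end Literature.Analysis.Complex
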